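import Literature.NumberTheory.EllipticCurves.BinaryQuarticPadicTubeVolume
import Mathlib.MeasureTheory.Constructions.Polish.Basic
import HarnessLib

/-!
# Bhargava–Shankar's `p`-adic change of measure for binary quartic forms (Props. 3.11–3.12):
# `μ_p(A) = |1/27|_p (1 − p⁻²) ∫ Σ_{orbits 𝒪 ⊆ A over (I,J)} 1/#Aut_{ℤ_p}(𝒪) dI dJ`

Companion of `BinaryQuarticPadicTubeVolume.lean` (the tube theorem: on one orbit tube
`∫⁻_A #Aut_{ℤ_p} dμ_p = (1 − p⁻²)|1/27|_p vol₂((I,J)(A ∩ S_r))`). Definitions (`fibreOrbits`,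
`fibreMass`), two instances and theorems; no named facts.

Source. M. Bhargava, A. Shankar, Ann. of Math. (2) 181 (2015) 191–242, Props. 3.11–3.12 of the
published version (Prop. 2.7 and the proof of Prop. 5.12 of `arXiv:1006.1002v2`: "The latter
integral can be computed using a Jacobian change of variables; indeed, Proposition 2.7 and the
principle of permanence of identities imply that
`∫_{f ∈ B_p^F} 1/#Aut(f) df = |2/27|_p · Vol(PGL₂(ℤ_p)) · ∫_{(I,J)} Σ_{f ∈ B_p^{I,J}} 1/#Aut(f)`";
Shankar–Wang, arXiv:1307.3531, Prop. 4.17 (42) for the printed shape with `#Stab_{G(ℤ_p)}`). For the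
twisted action of `GL₂(ℤ_p)` on `V_{ℤ_p}` and its measure `μ_p` this reads: **for every
`GL₂(ℤ_p)`-invariant measurable `A ⊆ {Δ ≠ 0}`,**

  `μ_p(A) = (1 − p⁻²) · |1/27|_p · ∫⁻_{(I,J) ∈ ℤ_p²} Σ_{𝒪 ⊆ A, (I,J)(𝒪) = (I,J)} 1/#Aut_{ℤ_p}(𝒪) dI dJ`

(`BinaryQuartic.volume_eq_lintegral_fibreMass`).

Normalisations. The constant here is `(1 − p⁻²) · |1/27|_p`, where `1 − p⁻² = #PGL₂(𝔽_p)/p³`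
arises as `[GL₂(ℤ_p) : ℤ_pˣK_r] · p^{−3r}` (the count of translates of the chart image) and
`|1/27|_p = |det J_Ψ|_p/|m|_p` is the Jacobian factor; `#Aut_{ℤ_p}(𝒪) = [Stab_{GL₂(ℤ_p)} : ℤ_pˣ]`
is the stabiliser in `PGL₂(ℤ_p)`. Bhargava–Shankar print the intermediate identity as
`|2/27|_p · Vol(PGL₂(ℤ_p)) · ∫ Σ 1/#Aut(f)` with `Vol` and `Aut` in the normalisations of their §2;
the two bookkeepings are reconciled by the end result: combined with Cor. 3.8 and Lemmas 5.10–5.11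
the present constant yields exactly the printed density `∫ φ_p = |2¹⁰/3³|_p · M_p(V,F)` of
Prop. 5.12 with the tree's `M_p(V,F) = (1 − p⁻²) ∫ #(E/2E)/#E[2]` (`localMassV`), see
`BhargavaShankarLocalDensity.lean`; no separate factor `|2|_p` remains at `p = 2`.

Proof: every form with `Δ ≠ 0` is the centre of an
orbit tube satisfying the hypotheses of the tube theorem and containing a neighbourhood of it
(`exists_tube_nhds`); countably many tubes cover `{Δ ≠ 0}` (second countability); disjointify them
into invariant measurable pieces `D_n`, apply the tube theorem to `A ∩ D_n ∩ {#Aut = a}`, and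
re-index the resulting sum of indicator functions of `(I,J)`-images as the sum over the orbits in
each fibre (the fibres of `(I, J)` in a tube being single orbits).

## References

* M. Bhargava, A. Shankar, Ann. of Math. (2) 181 (2015) 191–242, Props. 3.11–3.12 / Cor. 3.8
  (published numbering); Prop. 2.7 and proof of Prop. 5.12 (arXiv:1006.1002v2).
  [cite: BhargavaShankarAnnals2015, Prop. 5.12 proof (p-adic change of measure; arXiv:1006.1002v2 numbering)]
* A. Shankar, X. Wang, Compos. Math. 154 (2018) = arXiv:1307.3531, Prop. 4.17, eq. (42).
-/

noncomputable section

open scoped Classical Pointwise ENNReal NNReal Topology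
open Matrix MulAction Set Metric MvPolynomial MeasureTheory Filter Literature.GroupTheory.Index

namespace Literature.NumberTheory.EllipticCurves

namespace BinaryQuartic

open scoped IntegralAction

variable {p : ℕ} [Fact p.Prime]

local notation "G" => GL (Fin 2) ℤ_[p]

/-! ## §1 Orbits in a fibre and the fibre mass -/

/-- The orbits (points of the orbit quotient) contained in `A` whose invariants are `IJ`. [folklore] -/
def fibreOrbits (A : Set (BinaryQuartic ℤ_[p])) (IJ : ℤ_[p] × ℤ_[p]) : Set (orbitRel.Quotient G (BinaryQuartic ℤ_[p])) :=
  {q | orbitRel.Quotient.orbit q ⊆ A ∧ ∀ f ∈ orbitRel.Quotient.orbit q, invPair f = IJ}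

/-- **The fibre mass** `N_A(I,J) = Σ_{𝒪 ⊆ A, (I,J)(𝒪) = (I,J)} 1/#Aut_{ℤ_p}(𝒪)` (an unconditional sum
in `[0, ∞]`). [cite: BhargavaShankarAnnals2015, Prop. 5.12 proof (Σ_{f ∈ B_p^{I,J}} 1/#Aut(f); arXiv:1006.1002v2 numbering)] -/
def fibreMass (A : Set (BinaryQuartic ℤ_[p])) (IJ : ℤ_[p] × ℤ_[p]) : ℝ≥0∞ :=
  ∑' q : fibreOrbits A IJ, ((autCard (Quotient.out (q : orbitRel.Quotient G (BinaryQuartic ℤ_[p]))) : ℝ≥0∞))⁻¹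

/-- `autCard` is constant on orbits: it may be computed at any point of the orbit. [folklore] -/
theorem autCard_eq_of_mem_orbit {q : orbitRel.Quotient G (BinaryQuartic ℤ_[p])} {f : BinaryQuartic ℤ_[p]}
    (hf : f ∈ orbitRel.Quotient.orbit q) : autCard f = autCard (Quotient.out q) := by
  rw [orbitRel.Quotient.orbit_eq_orbit_out q Quotient.out_eq', mem_orbit_iff] at hf
  obtain ⟨g, rfl⟩ := hf
  exact autCard_smul g _

/-! ## §2 Every form with `Δ ≠ 0` is the centre of a good tube -/

/-- `V_{ℤ_p}` is second countable. [folklore] -/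
instance instSecondCountable : SecondCountableTopology (BinaryQuartic ℤ_[p]) :=
  isInducing_coeffs.secondCountableTopology

/-- Some coordinate direction is transverse at a form with `Δ ≠ 0`: `m(f, e_κ) ≠ 0` in `ℤ_p`.
[folklore] -/
theorem exists_sliceJac_unitForm_ne_zero_padicInt (f : BinaryQuartic ℤ_[p]) (hΔ : f.disc ≠ 0) :
    ∃ κ : Fin 5, f.sliceJac (unitForm κ) ≠ 0 := by
  have hΔ' : (f.map PadicInt.Coe.ringHom).disc ≠ 0 := by rw [disc_map]; exact PadicInt.coe_ne_zero.mpr hΔ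
  obtain ⟨κ, hκ⟩ := exists_sliceJac_unitForm_ne_zero (K := ℚ_[p]) (by norm_num) (by norm_num) hΔ'
  refine ⟨κ, fun h0 ↦ hκ ?_⟩
  have hmapu : (unitForm κ : BinaryQuartic ℤ_[p]).map PadicInt.Coe.ringHom = unitForm κ := by
    apply coeffs_injective
    rw [coeffs_unitForm]
    funext i
    rw [coeffs_map, coeffs_unitForm]
    by_cases h : i = κ
    · subst h; simp
    · simp [h]
  rw [← hmapu, sliceJac_map, h0, map_zero]

/-- `pʳ ∤ 2` in `ℤ_p` for `r ≥ 2`. [folklore] -/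
theorem not_pow_dvd_two {r : ℕ} (hr : 2 ≤ r) : ¬ (p : ℤ_[p]) ^ r ∣ 2 := by
  intro h
  rw [pow_dvd_iff_norm_le_zpow] at h
  have hp2 : (2 : ℝ) ≤ p := by exact_mod_cast (Fact.out : p.Prime).two_le
  have hp1 : (1 : ℝ) < p := by linarith
  -- `‖2‖ ≥ 1/2 > p⁻ʳ`
  have h2 : (1 / 2 : ℝ) ≤ ‖(2 : ℤ_[p])‖ := by
    have : ‖(2 : ℤ_[p])‖ = ‖((2 : ℕ) : ℤ_[p])‖ := by norm_num
    rw [this]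
    rcases eq_or_ne p 2 with hp | hp
    · subst hp
      have : ((2 : ℕ) : ℤ_[2]) = (2 : ℤ_[2]) ^ 1 := by norm_num
      rw [this, show ((2 : ℤ_[2]) : ℤ_[2]) = ((2 : ℕ) : ℤ_[2]) by norm_num, PadicInt.norm_p_pow]
      norm_num
    · rw [(PadicInt.norm_natCast_eq_one_iff).mpr]
      · norm_num
      · exact (Nat.coprime_primes (Fact.out : p.Prime) Nat.prime_two).mpr hp
  have hlt : (p : ℝ) ^ (-(r : ℤ)) < 1 / 2 := by
    calc (p : ℝ) ^ (-(r : ℤ)) ≤ (p : ℝ) ^ (-(2 : ℤ)) := zpow_le_zpow_right₀ hp1.le (by omega)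
      _ = 1 / (p : ℝ) ^ 2 := by rw [_root_.zpow_neg, zpow_ofNat, one_div]
      _ ≤ 1 / 4 := by
        apply one_div_le_one_div_of_le (by norm_num)
        nlinarith
      _ < 1 / 2 := by norm_num
  linarith

/-- Forms on a fine slice have nonzero discriminant: if `p⁻ʳ < |Δ(f₁)|_p` then `Δ(s) ≠ 0` for all
`s ∈ S_r` (`s ≡ f₁ (mod pʳ)`). [folklore] -/
theorem disc_ne_zero_of_mem_slice {f₁ w : BinaryQuartic ℤ_[p]} {r : ℕ}
    (hr : (p : ℝ) ^ (-(r : ℤ)) < ‖f₁.disc‖) {s : BinaryQuartic ℤ_[p]} (hs : s ∈ slice f₁ w r) : s.disc ≠ 0 := by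
  obtain ⟨u, v, hu, hv, rfl⟩ := hs
  rw [← pow_dvd_iff_norm_le_zpow] at hu hv
  obtain ⟨u', rfl⟩ := hu
  obtain ⟨v', rfl⟩ := hv
  have hform : (1 + (p : ℤ_[p]) ^ r * u') • f₁ + ((p : ℤ_[p]) ^ r * v') • w = f₁ + ((p : ℤ_[p]) ^ r) • (u' • f₁ + v' • w) := by
    rw [add_smul, one_smul, smul_add, smul_smul, smul_smul, add_assoc]
  rw [hform]
  refine ne_zero_of_congr_of_norm_gt (dvd_disc_add_smul_sub f₁ _ _) ?_
  rwa [← zpow_neg_natCast_eq]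

/-- **The chart image contains a congruence ball about its centre**: if
`‖coeffs f − coeffs f₁‖ ≤ p⁻ʳ · |det J_Ψ|_p` then `f ∈ W_r`. [folklore] -/
theorem mem_chartImage_of_norm_le {f₁ w : BinaryQuartic ℤ_[p]} {r : ℕ}
    (hm : (p : ℝ) ^ (-(r : ℤ)) < ‖f₁.sliceJac w‖) {f : BinaryQuartic ℤ_[p]}
    (hf : ‖f.coeffs - f₁.coeffs‖ ≤ ‖(jacOrbit f₁ w).det‖ * (p : ℝ) ^ (-(r : ℤ))) : f ∈ chartImage f₁ w r := by
  have hd : (Matrix.of fun i j ↦ MvPolynomial.eval chartCenter (pderiv j (orbitChart f₁ w i))).det ≠ 0 := by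
    rw [jacobian_orbitChart]
    intro h0
    have := norm_sliceJac_le_norm_det_jacOrbit f₁ w
    rw [h0, norm_zero] at this
    exact (lt_irrefl _ ((hm.trans_le this).trans_le' (by positivity))).elim
  have hrd : (p : ℝ) ^ (-(r : ℤ)) < ‖(Matrix.of fun i j ↦ MvPolynomial.eval chartCenter (pderiv j (orbitChart f₁ w i))).det‖ := by
    rw [jacobian_orbitChart]; exact hm.trans_le (norm_sliceJac_le_norm_det_jacOrbit f₁ w)
  have himg := Literature.RingTheory.HenselLemma.image_eval_closedBall_eq (orbitChart f₁ w) chartCenter hd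
    (by positivity) hrd
  rw [jacobian_orbitChart, eval_orbitChart_center] at himg
  have hr1 : (p : ℝ) ^ (-(r : ℤ)) ≤ 1 := zpow_le_one_of_nonpos₀ (by exact_mod_cast (Fact.out : p.Prime).one_lt.le) (by omega)
  obtain ⟨z, hz, hzn⟩ := Literature.RingTheory.HenselLemma.exists_mulVec_eq_of_norm_le (jacOrbit f₁ w)
    (by rw [← jacobian_orbitChart]; exact hd) (by positivity) hr1 hf
  have hmem : f.coeffs ∈ (fun x ↦ fun i ↦ MvPolynomial.eval x (orbitChart f₁ w i)) '' closedBall chartCenter ((p : ℝ) ^ (-(r : ℤ))) := by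
    rw [himg]
    refine ⟨z, mem_closedBall.mpr (by rwa [dist_zero_right]), ?_⟩
    simp only [hz, add_sub_cancel]
  obtain ⟨x, hx, hxf⟩ := hmem
  refine ⟨x, hx, coeffs_injective ?_⟩
  beta_reduce at hxf
  rw [coeffs_orbitChartForm]
  exact hxf

/-- **The tube is a neighbourhood of its centre.** [folklore] -/
theorem tube_mem_nhds {f₁ w : BinaryQuartic ℤ_[p]} {r : ℕ} (hr : 1 ≤ r)
    (hm : (p : ℝ) ^ (-(r : ℤ)) < ‖f₁.sliceJac w‖) : tube f₁ w r ∈ 𝓝 f₁ := by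
  have hdet : 0 < ‖(jacOrbit f₁ w).det‖ := by
    refine lt_of_lt_of_le ?_ (norm_sliceJac_le_norm_det_jacOrbit f₁ w)
    exact hm.trans_le' (by positivity)
  have hρ : 0 < ‖(jacOrbit f₁ w).det‖ * (p : ℝ) ^ (-(r : ℤ)) :=
    mul_pos hdet (zpow_pos (by exact_mod_cast (Fact.out : p.Prime).pos) _)
  -- the congruence ball in coefficients is a neighbourhood
  have hball : coeffs ⁻¹' closedBall f₁.coeffs (‖(jacOrbit f₁ w).det‖ * (p : ℝ) ^ (-(r : ℤ))) ∈ 𝓝 f₁ :=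
    continuous_coeffs.continuousAt (closedBall_mem_nhds _ hρ)
  refine Filter.mem_of_superset hball fun f hf ↦ ?_
  rw [mem_preimage, mem_closedBall, dist_eq_norm] at hf
  exact chartImage_subset_tube f₁ w hr (mem_chartImage_of_norm_le hm hf)

/-- **Every form with `Δ ≠ 0` is the centre of a tube satisfying the hypotheses of the tube theorem
and containing a neighbourhood of it.** [folklore] -/
theorem exists_tube_nhds (f₁ : BinaryQuartic ℤ_[p]) (hΔ : f₁.disc ≠ 0) :
    ∃ κ : Fin 5, ∃ r : ℕ, 1 ≤ r ∧ ¬ (p : ℤ_[p]) ^ r ∣ 2 ∧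
      (p : ℝ) ^ (-(r : ℤ)) < ‖f₁.sliceJac (unitForm κ)‖ ∧
      (∀ s ∈ slice f₁ (unitForm κ) r, s.disc ≠ 0) ∧ tube f₁ (unitForm κ) r ∈ 𝓝 f₁ := by
  obtain ⟨κ, hκ⟩ := exists_sliceJac_unitForm_ne_zero_padicInt f₁ hΔ
  obtain ⟨r₁, hr₁⟩ := PadicInt.exists_pow_neg_lt p (norm_pos_iff.mpr hκ)
  obtain ⟨r₂, hr₂⟩ := PadicInt.exists_pow_neg_lt p (norm_pos_iff.mpr hΔ)
  set r := r₁ + r₂ + 2 with hr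
  have hp1 : (1 : ℝ) < p := by exact_mod_cast (Fact.out : p.Prime).one_lt
  have hmono : ∀ {a b : ℕ}, a ≤ b → (p : ℝ) ^ (-(b : ℤ)) ≤ (p : ℝ) ^ (-(a : ℤ)) := fun hab ↦
    zpow_le_zpow_right₀ hp1.le (by omega)
  have hm : (p : ℝ) ^ (-(r : ℤ)) < ‖f₁.sliceJac (unitForm κ)‖ := (hmono (by omega)).trans_lt hr₁
  have hΔr : (p : ℝ) ^ (-(r : ℤ)) < ‖f₁.disc‖ := (hmono (by omega)).trans_lt hr₂
  exact ⟨κ, r, by omega, not_pow_dvd_two (by omega), hm, fun s hs ↦ disc_ne_zero_of_mem_slice hΔr hs,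
    tube_mem_nhds (by omega) hm⟩

/-! ## §3 A countable family of good tubes covering `{Δ ≠ 0}`, disjointified -/

/-- The data of a good tube: centre, direction index, level. [folklore] -/
structure TubeData (p : ℕ) [Fact p.Prime] where
  /-- the centre -/
  centre : BinaryQuartic ℤ_[p]
  /-- the transverse coordinate direction -/
  κ : Fin 5
  /-- the level -/
  r : ℕ
  one_le : 1 ≤ r
  not_dvd_two : ¬ (p : ℤ_[p]) ^ r ∣ 2
  lt_norm : (p : ℝ) ^ (-(r : ℤ)) < ‖centre.sliceJac (unitForm κ)‖
  disc_ne : ∀ s ∈ slice centre (unitForm κ) r, s.disc ≠ 0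

namespace TubeData

/-- The tube of a tube datum. [folklore] -/
def set (D : TubeData p) : Set (BinaryQuartic ℤ_[p]) := tube D.centre (unitForm D.κ) D.r

/-- The slice of a tube datum. [folklore] -/
def sl (D : TubeData p) : Set (BinaryQuartic ℤ_[p]) := slice D.centre (unitForm D.κ) D.r

end TubeData

/-- A form with nonzero discriminant: `x³y + y⁴` (`Δ = −27`). [folklore] -/
theorem disc_witness_ne_zero : (⟨0, 1, 0, 0, 1⟩ : BinaryQuartic ℤ_[p]).disc ≠ 0 := by
  simp only [disc]; norm_num

/-- **A countable family of good tubes covering `{Δ ≠ 0}`** (second countability). [folklore] -/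
theorem exists_countable_tube_cover :
    ∃ D : ℕ → TubeData p, {f : BinaryQuartic ℤ_[p] | f.disc ≠ 0} ⊆ ⋃ n, (D n).set := by
  -- a good tube at every point (at points with `Δ = 0`, any datum)
  obtain ⟨κ₀, r₀, h1₀, h2₀, hm₀, hΔ₀, -⟩ := exists_tube_nhds (⟨0, 1, 0, 0, 1⟩ : BinaryQuartic ℤ_[p]) disc_witness_ne_zero
  let D₀ : TubeData p := ⟨⟨0, 1, 0, 0, 1⟩, κ₀, r₀, h1₀, h2₀, hm₀, hΔ₀⟩
  have hchoice : ∀ f : BinaryQuartic ℤ_[p], ∃ D : TubeData p, f.disc ≠ 0 → D.set ∈ 𝓝 f := by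
    intro f
    by_cases hf : f.disc ≠ 0
    · obtain ⟨κ, r, h1, h2, hm, hΔ, hnhds⟩ := exists_tube_nhds f hf
      exact ⟨⟨f, κ, r, h1, h2, hm, hΔ⟩, fun _ ↦ hnhds⟩
    · exact ⟨D₀, fun h ↦ absurd h hf⟩
  choose D hD using hchoice
  set S : Set (BinaryQuartic ℤ_[p]) := {f | f.disc ≠ 0} with hS
  obtain ⟨t, htS, htc, hcover⟩ := TopologicalSpace.countable_cover_nhdsWithin
    (f := fun f : BinaryQuartic ℤ_[p] ↦ (D f).set) (s := S) (fun f hf ↦ mem_nhdsWithin_of_mem_nhds (hD f hf))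
  have ht : t.Nonempty := by
    by_contra hte
    rw [not_nonempty_iff_eq_empty] at hte
    have hw : (⟨0, 1, 0, 0, 1⟩ : BinaryQuartic ℤ_[p]) ∈ S := disc_witness_ne_zero
    have := hcover hw
    rw [hte] at this
    simp at this
  obtain ⟨e, he⟩ := htc.exists_eq_range ht
  refine ⟨fun n ↦ D (e n), fun f hf ↦ ?_⟩
  have := hcover hf
  rw [mem_iUnion₂] at this
  obtain ⟨x, hx, hfx⟩ := this
  rw [he] at hx
  obtain ⟨n, rfl⟩ := hx
  exact mem_iUnion.mpr ⟨n, hfx⟩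

/-- The disjointified pieces `E_n = U_n ∖ ⋃_{k<n} U_k`. [folklore] -/
def piece (D : ℕ → TubeData p) (n : ℕ) : Set (BinaryQuartic ℤ_[p]) :=
  (D n).set \ ⋃ k < n, (D k).set

/-- The pieces are pairwise disjoint. [folklore] -/
theorem disjoint_piece (D : ℕ → TubeData p) : Pairwise (Function.onFun Disjoint (piece D)) := by
  intro m n hmn
  rcases lt_or_gt_of_ne hmn with h | h
  · refine disjoint_left.mpr fun f hfm hfn ↦ hfn.2 ?_
    exact mem_biUnion h hfm.1
  · refine disjoint_left.mpr fun f hfm hfn ↦ hfm.2 ?_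
    exact mem_biUnion h hfn.1

/-- The pieces cover what the tubes cover. [folklore] -/
theorem iUnion_piece (D : ℕ → TubeData p) : ⋃ n, piece D n = ⋃ n, (D n).set := by
  apply le_antisymm
  · exact iUnion_mono fun n f hf ↦ hf.1
  · intro f hf
    obtain ⟨n, hn⟩ := mem_iUnion.mp hf
    -- the least index
    classical
    have hex : ∃ n, f ∈ (D n).set := ⟨n, hn⟩
    refine mem_iUnion.mpr ⟨Nat.find hex, Nat.find_spec hex, ?_⟩
    intro hf'
    obtain ⟨k, hk, hfk⟩ := mem_iUnion₂.mp hf'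
    exact Nat.find_min hex hk hfk

/-- The tubes are invariant. [folklore] -/
theorem smul_mem_tubeSet_iff (D : TubeData p) (g : G) (f : BinaryQuartic ℤ_[p]) : g • f ∈ D.set ↔ f ∈ D.set :=
  smul_mem_tube_iff g

/-- The pieces are invariant. [folklore] -/
theorem smul_mem_piece_iff (D : ℕ → TubeData p) (n : ℕ) (g : G) (f : BinaryQuartic ℤ_[p]) :
    g • f ∈ piece D n ↔ f ∈ piece D n := by
  simp only [piece, Set.mem_sdiff, mem_iUnion, smul_mem_tubeSet_iff, exists_prop]

/-- The tubes are measurable. [folklore] -/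
theorem measurableSet_tubeSet (D : TubeData p) : MeasurableSet D.set := measurableSet_tube D.one_le

/-- The pieces are measurable. [folklore] -/
theorem measurableSet_piece (D : ℕ → TubeData p) (n : ℕ) : MeasurableSet (piece D n) :=
  (measurableSet_tubeSet (D n)).diff (MeasurableSet.biUnion (to_countable _) fun k _ ↦ measurableSet_tubeSet (D k))


/-! ## §4 Level pieces `A ∩ E_n ∩ {#Aut = a}` and their volumes -/

/-- On a tube, `#Aut_{ℤ_p} ≥ 1` (it is the positive multiplicity `N`). [folklore] -/
theorem one_le_autCard_of_mem_tubeSet (D : TubeData p) {f : BinaryQuartic ℤ_[p]} (hf : f ∈ D.set) : 1 ≤ autCard f := by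
  rw [← mult_eq_autCard D.one_le D.not_dvd_two D.lt_norm D.disc_ne hf, mult]
  have hf' := hf
  rw [TubeData.set, tube_eq_iUnion D.one_le] at hf'
  obtain ⟨q, hq⟩ := mem_iUnion.mp hf'
  haveI : Nonempty {q : G ⧸ levelSubgroup (p := p) D.r // f ∈ q.out • chartImage D.centre (unitForm D.κ) D.r} := ⟨⟨q, hq⟩⟩
  exact Nat.one_le_iff_ne_zero.mpr (Nat.card_pos (α := {q : G ⧸ levelSubgroup (p := p) D.r //
    f ∈ q.out • chartImage D.centre (unitForm D.κ) D.r})).ne'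

/-- The level pieces `A ∩ E_n ∩ {#Aut = a}`. [folklore] -/
def levelPiece (D : ℕ → TubeData p) (A : Set (BinaryQuartic ℤ_[p])) (n a : ℕ) : Set (BinaryQuartic ℤ_[p]) :=
  A ∩ piece D n ∩ {f | autCard f = a}

/-- Level pieces lie in their tube. [folklore] -/
theorem levelPiece_subset (D : ℕ → TubeData p) (A : Set (BinaryQuartic ℤ_[p])) (n a : ℕ) :
    levelPiece D A n a ⊆ (D n).set := fun _ hf ↦ hf.1.2.1

/-- Level pieces are invariant (for invariant `A`). [folklore] -/
theorem smul_mem_levelPiece_iff (D : ℕ → TubeData p) {A : Set (BinaryQuartic ℤ_[p])}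
    (hA : ∀ g : G, ∀ f, g • f ∈ A ↔ f ∈ A) (n a : ℕ) (g : G) (f : BinaryQuartic ℤ_[p]) :
    g • f ∈ levelPiece D A n a ↔ f ∈ levelPiece D A n a := by
  simp only [levelPiece, mem_inter_iff, mem_setOf_eq, hA, smul_mem_piece_iff, autCard_smul]

/-- Level pieces are measurable (on the tube `#Aut` is the measurable multiplicity). [folklore] -/
theorem measurableSet_levelPiece (D : ℕ → TubeData p) {A : Set (BinaryQuartic ℤ_[p])} (hAm : MeasurableSet A) (n a : ℕ) :
    MeasurableSet (levelPiece D A n a) := by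
  have heq : levelPiece D A n a =
      A ∩ piece D n ∩ ((fun f ↦ (mult (D n).centre (unitForm (D n).κ) (D n).r f : ℝ≥0∞)) ⁻¹' {(a : ℝ≥0∞)}) := by
    ext f
    simp only [levelPiece, mem_inter_iff, mem_setOf_eq, mem_preimage, mem_singleton_iff, Nat.cast_inj]
    constructor
    · rintro ⟨⟨hfA, hfp⟩, hfa⟩
      exact ⟨⟨hfA, hfp⟩, by rw [mult_eq_autCard (D n).one_le (D n).not_dvd_two (D n).lt_norm (D n).disc_ne hfp.1, hfa]⟩
    · rintro ⟨⟨hfA, hfp⟩, hfa⟩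
      exact ⟨⟨hfA, hfp⟩, by rw [← mult_eq_autCard (D n).one_le (D n).not_dvd_two (D n).lt_norm (D n).disc_ne hfp.1, hfa]⟩
  rw [heq]
  exact (hAm.inter (measurableSet_piece D n)).inter ((measurable_mult _ _ _) (measurableSet_singleton _))

/-- The constant of the change of measure, `(1 − p⁻²) |1/27|_p`, is finite and nonzero. [folklore] -/
theorem massConst_ne_top : ((p ^ 2 - 1 : ℕ) : ℝ≥0∞) / (p : ℝ≥0∞) ^ 2 * (‖(27 : ℤ_[p])‖₊ : ℝ≥0∞)⁻¹ ≠ ⊤ := by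
  have hp0 : (p : ℝ≥0∞) ^ 2 ≠ 0 := pow_ne_zero _ (by exact_mod_cast (Fact.out : p.Prime).ne_zero)
  have h27 : (‖(27 : ℤ_[p])‖₊ : ℝ≥0∞) ≠ 0 := by
    rw [ENNReal.coe_ne_zero]; exact nnnorm_ne_zero_iff.mpr (by norm_num)
  exact ENNReal.mul_ne_top (ENNReal.div_ne_top (ENNReal.natCast_ne_top _) hp0) (ENNReal.inv_ne_top.mpr h27)

/-- **Volume of a level piece**: `μ_p(A ∩ E_n ∩ {#Aut = a}) = a⁻¹ · (1−p⁻²)|1/27|_p · vol₂((I,J)(… ∩ S^{(n)}))`.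
[folklore] -/
theorem volume_levelPiece (D : ℕ → TubeData p) {A : Set (BinaryQuartic ℤ_[p])} (hAm : MeasurableSet A)
    (hA : ∀ g : G, ∀ f, g • f ∈ A ↔ f ∈ A) (n a : ℕ) :
    volume (levelPiece D A n a) = (a : ℝ≥0∞)⁻¹ *
      (((p ^ 2 - 1 : ℕ) : ℝ≥0∞) / (p : ℝ≥0∞) ^ 2 * (‖(27 : ℤ_[p])‖₊ : ℝ≥0∞)⁻¹ *
        volume (invPair '' (levelPiece D A n a ∩ (D n).sl))) := by
  rcases Nat.eq_zero_or_pos a with rfl | ha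
  · -- `a = 0`: the piece is empty
    have hempty : levelPiece D A n 0 = ∅ := by
      apply eq_empty_of_forall_notMem
      intro f hf
      have h1 := one_le_autCard_of_mem_tubeSet (D n) (levelPiece_subset D A n 0 hf)
      rw [hf.2] at h1
      exact Nat.not_succ_le_zero 0 h1
    rw [hempty, empty_inter, image_empty, measure_empty, measure_empty, mul_zero, mul_zero]
  · have htube := setLIntegral_autCard_tube (D n).centre (unitForm (D n).κ) (D n).one_le (D n).not_dvd_two (D n).lt_norm
      (D n).disc_ne (measurableSet_levelPiece D hAm n a) (smul_mem_levelPiece_iff D hA n a) (levelPiece_subset D A n a)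
    have hconst : ∫⁻ f in levelPiece D A n a, (autCard f : ℝ≥0∞) = (a : ℝ≥0∞) * volume (levelPiece D A n a) := by
      rw [← setLIntegral_const]
      refine setLIntegral_congr_fun (measurableSet_levelPiece D hAm n a) fun f hf ↦ ?_
      rw [hf.2]
    rw [hconst] at htube
    have ha0 : (a : ℝ≥0∞) ≠ 0 := by exact_mod_cast ha.ne'
    have hat : (a : ℝ≥0∞) ≠ ⊤ := ENNReal.natCast_ne_top a
    calc volume (levelPiece D A n a) = (a : ℝ≥0∞)⁻¹ * ((a : ℝ≥0∞) * volume (levelPiece D A n a)) := by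
          rw [← mul_assoc, ENNReal.inv_mul_cancel ha0 hat, one_mul]
      _ = _ := by rw [htube]; rfl

/-! ## §5 `μ_p(A) = Σ_n Σ_a μ_p(A ∩ E_n ∩ {#Aut = a})` -/

/-- **`μ_p(A) = Σ_n Σ_a μ_p(level pieces)`** for measurable `A ⊆ {Δ ≠ 0}`. [folklore] -/
theorem volume_eq_tsum_levelPiece (D : ℕ → TubeData p) (hD : {f : BinaryQuartic ℤ_[p] | f.disc ≠ 0} ⊆ ⋃ n, (D n).set)
    {A : Set (BinaryQuartic ℤ_[p])} (hAm : MeasurableSet A) (hAS : A ⊆ {f | f.disc ≠ 0}) :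
    volume A = ∑' n, ∑' a, volume (levelPiece D A n a) := by
  have hcov : A = ⋃ n, A ∩ piece D n := by
    rw [← inter_iUnion, iUnion_piece, inter_eq_left.mpr (hAS.trans hD)]
  have hdisj : Pairwise (Function.onFun Disjoint fun n ↦ A ∩ piece D n) := fun m n hmn ↦
    (disjoint_piece D hmn).mono inter_subset_right inter_subset_right
  conv_lhs => rw [hcov]
  rw [measure_iUnion hdisj fun n ↦ hAm.inter (measurableSet_piece D n)]
  refine tsum_congr fun n ↦ ?_
  have hcov' : A ∩ piece D n = ⋃ a, levelPiece D A n a := by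
    ext f; simp [levelPiece]
  have hdisj' : Pairwise (Function.onFun Disjoint fun a ↦ levelPiece D A n a) := fun a b hab ↦
    disjoint_left.mpr fun f hfa hfb ↦ hab (hfa.2.symm.trans hfb.2)
  rw [hcov', measure_iUnion hdisj' fun a ↦ measurableSet_levelPiece D hAm n a]

/-! ## §6 Re-indexing: the sum of indicators is the fibre mass -/

section Reindex

variable (D : ℕ → TubeData p) (A : Set (BinaryQuartic ℤ_[p])) (IJ : ℤ_[p] × ℤ_[p])

/-- The slice points of `A ∩ E_n` over `IJ` (at most one for each `n`). [folklore] -/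
def SliceWitness (n : ℕ) : Prop := ∃ s ∈ A ∩ piece D n ∩ (D n).sl, invPair s = IJ

variable {D A IJ}

/-- Uniqueness of the slice point over `IJ` in `S^{(n)}`. [folklore] -/
theorem sliceWitness_unique {n : ℕ} {s s' : BinaryQuartic ℤ_[p]} (hs : s ∈ (D n).sl) (hs' : s' ∈ (D n).sl)
    (h : invPair s = invPair s') : s = s' :=
  invPair_injOn_slice (D n).centre (unitForm (D n).κ) (D n).lt_norm hs hs' h

/-- The inner sum at level `n`: `Σ_a a⁻¹ 1_{T_{n,a}}(IJ)` is `(#Aut s)⁻¹` for the slice point `s` of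
`A ∩ E_n` over `IJ`, and `0` if there is none. [folklore] -/
theorem tsum_inv_mul_indicator_eq (n : ℕ) :
    ∑' a : ℕ, (a : ℝ≥0∞)⁻¹ * (invPair '' (levelPiece D A n a ∩ (D n).sl)).indicator 1 IJ =
      if h : SliceWitness D A IJ n then ((autCard h.choose : ℝ≥0∞))⁻¹ else 0 := by
  by_cases h : SliceWitness D A IJ n
  · rw [dif_pos h]
    obtain ⟨⟨⟨hsA, hsp⟩, hsl⟩, hsIJ⟩ := h.choose_spec
    set s := h.choose with hs
    have hind : ∀ a : ℕ, (invPair '' (levelPiece D A n a ∩ (D n).sl)).indicator (1 : ℤ_[p] × ℤ_[p] → ℝ≥0∞) IJ =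
        if autCard s = a then 1 else 0 := by
      intro a
      by_cases ha : autCard s = a
      · rw [if_pos ha, indicator_of_mem, Pi.one_apply]
        exact ⟨s, ⟨⟨⟨hsA, hsp⟩, ha⟩, hsl⟩, hsIJ⟩
      · rw [if_neg ha, indicator_of_notMem]
        rintro ⟨s', ⟨⟨⟨-, -⟩, hs'a⟩, hs'l⟩, hs'IJ⟩
        have : s' = s := sliceWitness_unique hs'l hsl (by rw [hs'IJ, hsIJ])
        exact ha (this ▸ hs'a)
    simp_rw [hind, mul_ite, mul_one, mul_zero]
    have hcomm : ∀ a : ℕ, (if autCard s = a then ((a : ℝ≥0∞))⁻¹ else (0 : ℝ≥0∞)) =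
        (if a = autCard s then ((a : ℝ≥0∞))⁻¹ else 0) := fun a ↦ by
      by_cases ha : a = autCard s
      · rw [if_pos ha, if_pos ha.symm]
      · rw [if_neg ha, if_neg (Ne.symm ha)]
    simp_rw [hcomm]
    rw [tsum_ite_eq]
  · rw [dif_neg h]
    refine ENNReal.tsum_eq_zero.mpr fun a ↦ ?_
    rw [indicator_of_notMem, mul_zero]
    rintro ⟨s, ⟨hsl, hssl⟩, hsIJ⟩
    exact h ⟨s, ⟨hsl.1, hssl⟩, hsIJ⟩

end Reindex


/-! ## §7 `Σ_n g_n(IJ) = N_A(IJ)`: slice witnesses ↔ orbits in the fibre -/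

section Reindex2

variable {D : ℕ → TubeData p} {A : Set (BinaryQuartic ℤ_[p])} {IJ : ℤ_[p] × ℤ_[p]}

/-- The orbit of a slice witness is an orbit of `A` over `IJ` (for invariant `A`). [folklore] -/
theorem mk_mem_fibreOrbits (hA : ∀ g : G, ∀ f, g • f ∈ A ↔ f ∈ A) {s : BinaryQuartic ℤ_[p]} (hsA : s ∈ A)
    (hsIJ : invPair s = IJ) :
    (Quotient.mk'' s : orbitRel.Quotient G (BinaryQuartic ℤ_[p])) ∈ fibreOrbits A IJ := by
  rw [fibreOrbits, mem_setOf_eq, orbitRel.Quotient.orbit_mk]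
  constructor
  · rintro _ ⟨g, rfl⟩; exact (hA g s).mpr hsA
  · rintro _ ⟨g, rfl⟩
    show invPair (g • s) = IJ
    rw [invPair_glInt_smul, hsIJ]

/-- The re-indexing map: a level `n` carrying a slice witness ↦ the orbit of the witness. [folklore] -/
def witnessOrbit (hA : ∀ g : G, ∀ f, g • f ∈ A ↔ f ∈ A) (n : {n // SliceWitness D A IJ n}) : fibreOrbits A IJ :=
  ⟨Quotient.mk'' n.2.choose, mk_mem_fibreOrbits hA n.2.choose_spec.1.1.1 n.2.choose_spec.2⟩

/-- The re-indexing map is injective (the pieces are disjoint and invariant). [folklore] -/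
theorem witnessOrbit_injective (hA : ∀ g : G, ∀ f, g • f ∈ A ↔ f ∈ A) :
    Function.Injective (witnessOrbit (D := D) (A := A) (IJ := IJ) hA) := by
  rintro ⟨n, hn⟩ ⟨m, hm⟩ h
  simp only [witnessOrbit, Subtype.mk.injEq] at h
  obtain ⟨⟨⟨-, hnp⟩, -⟩, -⟩ := hn.choose_spec
  obtain ⟨⟨⟨-, hmp⟩, -⟩, -⟩ := hm.choose_spec
  have hrel : hn.choose ∈ MulAction.orbit G hm.choose := by
    rw [← orbitRel.Quotient.orbit_mk, orbitRel.Quotient.mem_orbit, h]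
  obtain ⟨g, hg⟩ := hrel
  have hnm : hn.choose ∈ piece D m := by rw [← hg, smul_mem_piece_iff]; exact hmp
  by_contra hne
  have hne' : n ≠ m := fun h' ↦ hne (Subtype.ext h')
  exact (disjoint_left.mp (disjoint_piece D hne')) hnp hnm

/-- The re-indexing map is surjective (every orbit of `A` over `IJ` meets exactly one piece, inside
whose tube it is the fibre over `IJ`, meeting the slice). [folklore] -/
theorem witnessOrbit_surjective (hD : {f : BinaryQuartic ℤ_[p] | f.disc ≠ 0} ⊆ ⋃ n, (D n).set)
    (hA : ∀ g : G, ∀ f, g • f ∈ A ↔ f ∈ A) (hAS : A ⊆ {f | f.disc ≠ 0}) :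
    Function.Surjective (witnessOrbit (D := D) (A := A) (IJ := IJ) hA) := by
  rintro ⟨q, hqA, hqIJ⟩
  -- a point of the orbit, the piece containing it, and its slice representative
  set f := Quotient.out q with hf
  have hfq : f ∈ orbitRel.Quotient.orbit q := by rw [orbitRel.Quotient.mem_orbit]; exact Quotient.out_eq' q
  have hfA : f ∈ A := hqA hfq
  have hfU : f ∈ ⋃ n, piece D n := by rw [iUnion_piece]; exact hD (hAS hfA)
  obtain ⟨n, hfn⟩ := mem_iUnion.mp hfU
  obtain ⟨s, hs, g, hgs, -⟩ := exists_mem_slice_of_mem_tube (hfn.1 : f ∈ (D n).set)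
  have hsf : s = g⁻¹ • f := by rw [hgs, inv_smul_smul]
  have hsA : s ∈ A := by rw [hsf, hA]; exact hfA
  have hsp : s ∈ piece D n := by rw [hsf, smul_mem_piece_iff]; exact hfn
  have hsIJ : invPair s = IJ := by rw [hsf, invPair_glInt_smul]; exact hqIJ f hfq
  have hw : SliceWitness D A IJ n := ⟨s, ⟨⟨hsA, hsp⟩, hs⟩, hsIJ⟩
  refine ⟨⟨n, hw⟩, ?_⟩
  -- the chosen witness is `s`
  obtain ⟨⟨⟨-, -⟩, hcl⟩, hcIJ⟩ := hw.choose_spec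
  have hcs : hw.choose = s := sliceWitness_unique hcl hs (by rw [hcIJ, hsIJ])
  apply Subtype.ext
  simp only [witnessOrbit]
  rw [hcs, ← orbitRel.Quotient.mem_orbit, orbitRel.Quotient.orbit_eq_orbit_out q Quotient.out_eq', hsf]
  exact ⟨g⁻¹, rfl⟩

/-- **`Σ_n g_n(IJ) = N_A(IJ)`.** [folklore] -/
theorem tsum_sliceWitness_eq_fibreMass (hD : {f : BinaryQuartic ℤ_[p] | f.disc ≠ 0} ⊆ ⋃ n, (D n).set)
    (hA : ∀ g : G, ∀ f, g • f ∈ A ↔ f ∈ A) (hAS : A ⊆ {f | f.disc ≠ 0}) :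
    ∑' n, (if h : SliceWitness D A IJ n then ((autCard h.choose : ℝ≥0∞))⁻¹ else 0) = fibreMass A IJ := by
  set F : ℕ → ℝ≥0∞ := fun n ↦ if h : SliceWitness D A IJ n then ((autCard h.choose : ℝ≥0∞))⁻¹ else 0 with hF
  have hind : {n | SliceWitness D A IJ n}.indicator F = F := by
    funext n
    by_cases h : SliceWitness D A IJ n
    · exact Set.indicator_of_mem (show n ∈ {n | SliceWitness D A IJ n} from h) F
    · rw [Set.indicator_of_notMem (show n ∉ {n | SliceWitness D A IJ n} from h) F, hF]
      simp only [dif_neg h]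
  have h1 : ∑' n, F n = ∑' x : {n | SliceWitness D A IJ n}, F x := by rw [tsum_subtype, hind]
  rw [h1, fibreOrbits_tsum_eq]
  where
  /-- transport along the bijection -/
  fibreOrbits_tsum_eq :
      ∑' x : {n | SliceWitness D A IJ n}, (fun n ↦ if h : SliceWitness D A IJ n then ((autCard h.choose : ℝ≥0∞))⁻¹ else 0) x =
        fibreMass A IJ := by
    let e := Equiv.ofBijective _ ⟨witnessOrbit_injective (D := D) (A := A) (IJ := IJ) hA, witnessOrbit_surjective hD hA hAS⟩
    rw [fibreMass, ← Equiv.tsum_eq e]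
    refine tsum_congr fun x ↦ ?_
    have hx : SliceWitness D A IJ x.1 := x.2
    show (if h : SliceWitness D A IJ x.1 then ((autCard h.choose : ℝ≥0∞))⁻¹ else 0) =
      ((autCard (Quotient.out (Quotient.mk'' hx.choose : orbitRel.Quotient G (BinaryQuartic ℤ_[p]))) : ℝ≥0∞))⁻¹
    rw [dif_pos hx, autCard_eq_of_mem_orbit (q := (Quotient.mk'' hx.choose : orbitRel.Quotient G (BinaryQuartic ℤ_[p])))
      (f := hx.choose) (orbitRel.Quotient.mem_orbit.mpr rfl)]

end Reindex2

/-! ## §8 The change of measure -/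

/-- **Bhargava–Shankar's `p`-adic change of measure** (Props. 3.11–3.12 of the published version;
Prop. 2.7 + proof of Prop. 5.12 of arXiv v2). For every `GL₂(ℤ_p)`-invariant measurable
`A ⊆ {Δ ≠ 0} ⊆ V_{ℤ_p}`:

  `μ_p(A) = (1 − p⁻²) · |1/27|_p · ∫⁻_{(I,J) ∈ ℤ_p²} N_A(I, J)`,
  `N_A(I,J) = Σ_{orbits 𝒪 ⊆ A with invariants (I,J)} 1/#Aut_{ℤ_p}(𝒪)`

(with `(1 − p⁻²) = (p² − 1)/p² = Vol(PGL₂(ℤ_p))` and `|1/27|_p = ‖27‖⁻¹`).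
[cite: BhargavaShankarAnnals2015, Prop. 5.12 proof (|2/27|_p·Vol(PGL₂(ℤ_p))·∫Σ1/#Aut; arXiv:1006.1002v2 numbering)] -/
theorem volume_eq_lintegral_fibreMass {A : Set (BinaryQuartic ℤ_[p])} (hAm : MeasurableSet A)
    (hA : ∀ g : G, ∀ f, g • f ∈ A ↔ f ∈ A) (hAS : A ⊆ {f | f.disc ≠ 0}) :
    volume A = ((p ^ 2 - 1 : ℕ) : ℝ≥0∞) / (p : ℝ≥0∞) ^ 2 * (‖(27 : ℤ_[p])‖₊ : ℝ≥0∞)⁻¹ * ∫⁻ IJ, fibreMass A IJ := by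
  obtain ⟨D, hD⟩ := exists_countable_tube_cover (p := p)
  set c : ℝ≥0∞ := ((p ^ 2 - 1 : ℕ) : ℝ≥0∞) / (p : ℝ≥0∞) ^ 2 * (‖(27 : ℤ_[p])‖₊ : ℝ≥0∞)⁻¹ with hc
  rw [volume_eq_tsum_levelPiece D hD hAm hAS]
  have hT : ∀ n a : ℕ, MeasurableSet (invPair '' (levelPiece D A n a ∩ (D n).sl)) := fun n a ↦
    measurableSet_invPair_image (D n).centre (unitForm (D n).κ) (D n).lt_norm (measurableSet_levelPiece D hAm n a)
  have hmeas : ∀ n a : ℕ, Measurable fun IJ ↦ (a : ℝ≥0∞)⁻¹ * (invPair '' (levelPiece D A n a ∩ (D n).sl)).indicator 1 IJ :=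
    fun n a ↦ (measurable_one.indicator (hT n a)).const_mul _
  have hterm : ∀ n a : ℕ, volume (levelPiece D A n a) =
      c * ∫⁻ IJ, (a : ℝ≥0∞)⁻¹ * (invPair '' (levelPiece D A n a ∩ (D n).sl)).indicator 1 IJ := by
    intro n a
    rw [volume_levelPiece D hAm hA, lintegral_const_mul _ (measurable_one.indicator (hT n a)), lintegral_indicator_one (hT n a)]
    ring
  rw [tsum_congr fun n ↦ tsum_congr fun a ↦ hterm n a, tsum_congr fun n ↦ ENNReal.tsum_mul_left, ENNReal.tsum_mul_left]
  congr 1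
  calc ∑' n : ℕ, ∑' a : ℕ, ∫⁻ IJ, (a : ℝ≥0∞)⁻¹ * (invPair '' (levelPiece D A n a ∩ (D n).sl)).indicator 1 IJ
      = ∑' n : ℕ, ∫⁻ IJ, ∑' a : ℕ, (a : ℝ≥0∞)⁻¹ * (invPair '' (levelPiece D A n a ∩ (D n).sl)).indicator 1 IJ :=
        tsum_congr fun n ↦ (lintegral_tsum fun a ↦ (hmeas n a).aemeasurable).symm
    _ = ∫⁻ IJ, ∑' n : ℕ, ∑' a : ℕ, (a : ℝ≥0∞)⁻¹ * (invPair '' (levelPiece D A n a ∩ (D n).sl)).indicator 1 IJ :=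
        (lintegral_tsum fun n ↦ (Measurable.tsum fun a ↦ hmeas n a).aemeasurable).symm
    _ = ∫⁻ IJ, fibreMass A IJ := by
        refine lintegral_congr fun IJ ↦ ?_
        rw [tsum_congr fun n ↦ tsum_inv_mul_indicator_eq (D := D) (A := A) (IJ := IJ) n]
        exact tsum_sliceWitness_eq_fibreMass hD hA hAS

/-- **The fibre mass `N_A` is a measurable function of `(I, J)`** for invariant measurable
`A ⊆ {Δ ≠ 0}` (a countable sum of scaled indicator functions of Lusin–Souslin images). [folklore] -/
theorem measurable_fibreMass {A : Set (BinaryQuartic ℤ_[p])} (hAm : MeasurableSet A)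
    (hA : ∀ g : G, ∀ f, g • f ∈ A ↔ f ∈ A) (hAS : A ⊆ {f | f.disc ≠ 0}) :
    Measurable (fibreMass A) := by
  obtain ⟨D, hD⟩ := exists_countable_tube_cover (p := p)
  have hT : ∀ n a : ℕ, MeasurableSet (invPair '' (levelPiece D A n a ∩ (D n).sl)) := fun n a ↦
    measurableSet_invPair_image (D n).centre (unitForm (D n).κ) (D n).lt_norm (measurableSet_levelPiece D hAm n a)
  have hmeas : ∀ n a : ℕ, Measurable fun IJ ↦ (a : ℝ≥0∞)⁻¹ * (invPair '' (levelPiece D A n a ∩ (D n).sl)).indicator 1 IJ :=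
    fun n a ↦ (measurable_one.indicator (hT n a)).const_mul _
  have heq : fibreMass A = fun IJ ↦ ∑' n : ℕ, ∑' a : ℕ,
      (a : ℝ≥0∞)⁻¹ * (invPair '' (levelPiece D A n a ∩ (D n).sl)).indicator 1 IJ := by
    funext IJ
    rw [tsum_congr fun n ↦ tsum_inv_mul_indicator_eq (D := D) (A := A) (IJ := IJ) n]
    exact (tsum_sliceWitness_eq_fibreMass hD hA hAS).symm
  rw [heq]
  exact Measurable.tsum fun n ↦ Measurable.tsum fun a ↦ hmeas n a

end BinaryQuartic

end Literature.NumberTheory.EllipticCurves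

end
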